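import Summits.AtomisticToContinuum.Crystallization.Theorems.ChargedEnergyGapTiltEnvelope
import Summits.AtomisticToContinuum.Crystallization.Theorems.ChargedEnergyGapPhiConvex
import HarnessLib

/-!
# ChargedEnergyGap · NODE 98 «TiltConvex» — the tilt weights `t ↦ φ(√(tiltArg c ρ t))` are CONVEX in the depth variable; exact «capenv2» rows (L3, second order)

decomp-a2c lens-3 g90 (the tilt corollary of NODE 97 «PhiConvex», critic r1619: «as a separate theorem with its own hypothesis list»).  Imports tree
…ChargedEnergyGapTiltEnvelope (p855322; `tiltArg`, `tiltArg_mono_d`) + NODE 97 …ChargedEnergyGapPhiConvex (`depthProfile_convexOn`, `chord_upper`,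
`secant_lower`; lands FIRST — this file is checked on the farm as the concatenation 97 ⊕ 98 until then) + HarnessLib.

§98.1 `tiltArg c ρ t = (t − ρ + ρc)² + ρ²(2 − c²)` (ring) ⇒ for `c² ≤ 2` the root `√(tiltArg c ρ t) = ‖(t − ρ + ρc) + ρ√(2−c²)·i‖` is the norm of an
  AFFINE path in `ℂ`, hence CONVEX in `t` on all of `ℝ` (`sqrt_tiltArg_convexOn`; triangle inequality, no derivatives).
§98.2 Composition (generic): `g` convex and monotone on a convex `T`, `f` convex on `s` with `f '' s ⊆ T` ⇒ `g ∘ f` convex on `s` (`convexOn_comp_of_mapsTo`).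
§98.3 ★★★ `tiltWeight_convexOn`: for `0 ≤ c`, `c² ≤ 2`, `0 ≤ ρ ≤ lo`, `80² ≤ tiltArg c ρ lo`, `tiltArg c ρ hi ≤ 134²`:
  `ConvexOn ℝ (Set.Icc lo hi) (fun t ↦ depthProfile 160 (√(tiltArg c ρ t)))` — covers the three equatorial constants 439/485, 527/485, 483/485.
§98.4 The «capenv2» TILT rows: chord upper / secant-extension lower bounds for each tilt weight on a depth cell (NODE 97's generic `chord_upper` /
  `secant_lower`; three evaluations of the weight per row for each fixed `ρ`; the `ρ`-dependence is handled by the census generator through NODE 95's brackets).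

[SUPPORT node: all PROVED, 0 sorry, 0 defs, 8 theorems; no cone statement touched; no `set_option`; 124 lines.] -/

noncomputable section
open scoped Classical
open Literature.MathematicalPhysics.StatisticalMechanics Literature.Geometry.DiscreteGeometry
open Summit.AtomisticToContinuum.Crystallization.Theses.PricedLinkCensus
open Summit.AtomisticToContinuum.Crystallization.Theorems.ChargedEnergyGapNegative

namespace Summit.AtomisticToContinuum.Crystallization.Theorems.ChargedEnergyGapChartDial

/-! ## §98.1 The root of the tilt quadratic is convex in the depth variable -/

/-- [formal bookkeeping] completing the square: `tiltArg c ρ t = (t − ρ + ρc)² + ρ²(2 − c²)`. -/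
theorem tiltArg_eq_sq_add (c ρ t : ℝ) : tiltArg c ρ t = (t - ρ + ρ * c) ^ 2 + ρ ^ 2 * (2 - c ^ 2) := by
  unfold tiltArg; ring

/-- [formal bookkeeping] the root as a complex norm: `√(tiltArg c ρ t) = ‖(t − ρ + ρc) + √(ρ²(2−c²))·I‖` (`c² ≤ 2`). -/
theorem sqrt_tiltArg_eq_norm {c : ℝ} (hc : c ^ 2 ≤ 2) (ρ t : ℝ) :
    Real.sqrt (tiltArg c ρ t) = ‖((t - ρ + ρ * c : ℝ) : ℂ) + ((Real.sqrt (ρ ^ 2 * (2 - c ^ 2)) : ℝ) : ℂ) * Complex.I‖ := by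
  rw [Complex.norm_add_mul_I, Real.sq_sqrt (mul_nonneg (sq_nonneg ρ) (by linarith)), tiltArg_eq_sq_add]

/-- ★★ The root of the tilt quadratic is CONVEX in `t` on all of `ℝ` (norm of an affine path; `c² ≤ 2`). -/
theorem sqrt_tiltArg_convexOn {c : ℝ} (hc : c ^ 2 ≤ 2) (ρ : ℝ) :
    ConvexOn ℝ Set.univ (fun t => Real.sqrt (tiltArg c ρ t)) := by
  refine ⟨convex_univ, ?_⟩
  intro x _ y _ a b ha hb hab
  simp only [smul_eq_mul, sqrt_tiltArg_eq_norm hc]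
  set k : ℝ := Real.sqrt (ρ ^ 2 * (2 - c ^ 2)) with hk
  have hv : ((a * x + b * y - ρ + ρ * c : ℝ) : ℂ) + ((k : ℝ) : ℂ) * Complex.I =
      (a : ℂ) * (((x - ρ + ρ * c : ℝ) : ℂ) + ((k : ℝ) : ℂ) * Complex.I) +
      (b : ℂ) * (((y - ρ + ρ * c : ℝ) : ℂ) + ((k : ℝ) : ℂ) * Complex.I) := by
    have hab' : (a : ℂ) + (b : ℂ) = 1 := by exact_mod_cast hab
    push_cast
    linear_combination ((ρ : ℂ) - (ρ : ℂ) * (c : ℂ) - (k : ℂ) * Complex.I) * hab'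
  rw [hv]
  calc ‖(a : ℂ) * (((x - ρ + ρ * c : ℝ) : ℂ) + ((k : ℝ) : ℂ) * Complex.I) +
        (b : ℂ) * (((y - ρ + ρ * c : ℝ) : ℂ) + ((k : ℝ) : ℂ) * Complex.I)‖
      ≤ ‖(a : ℂ) * (((x - ρ + ρ * c : ℝ) : ℂ) + ((k : ℝ) : ℂ) * Complex.I)‖ +
        ‖(b : ℂ) * (((y - ρ + ρ * c : ℝ) : ℂ) + ((k : ℝ) : ℂ) * Complex.I)‖ := norm_add_le _ _
    _ = a * ‖((x - ρ + ρ * c : ℝ) : ℂ) + ((k : ℝ) : ℂ) * Complex.I‖ +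
        b * ‖((y - ρ + ρ * c : ℝ) : ℂ) + ((k : ℝ) : ℂ) * Complex.I‖ := by
        rw [norm_mul, norm_mul, Complex.norm_real, Complex.norm_real, Real.norm_of_nonneg ha, Real.norm_of_nonneg hb]

/-! ## §98.2 Composition of a convex monotone outer function with a convex inner function -/

/-- ★★ Generic: `g` convex and monotone on a convex set `T`, `f` convex on `s` and mapping `s` into `T` ⇒ `g ∘ f` convex on `s`
(Mathlib's `ConvexOn.comp` wants `g` convex on `f '' s` itself; this superset form is what the rows need). -/
theorem convexOn_comp_of_mapsTo {s T : Set ℝ} {f g : ℝ → ℝ} (hg : ConvexOn ℝ T g) (hg' : MonotoneOn g T)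
    (hf : ConvexOn ℝ s f) (hT : Set.MapsTo f s T) : ConvexOn ℝ s (fun t => g (f t)) := by
  refine ⟨hf.1, ?_⟩
  intro x hx y hy a b ha hb hab
  have hfx : f x ∈ T := hT hx
  have hfy : f y ∈ T := hT hy
  have hmix : f (a • x + b • y) ∈ T := hT (hf.1 hx hy ha hb hab)
  have hcomb : a • f x + b • f y ∈ T := hg.1 hfx hfy ha hb hab
  calc g (f (a • x + b • y)) ≤ g (a • f x + b • f y) := hg' hmix hcomb (hf.2 hx hy ha hb hab)
    _ ≤ a • g (f x) + b • g (f y) := hg.2 hfx hfy ha hb hab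

/-! ## §98.3 The tilt weights are convex in the depth variable -/

/-- [formal bookkeeping] range control: `80² ≤ tiltArg ≤ 134²` along `[lo, hi]` puts the root in `[80, 134]`. -/
theorem sqrt_tiltArg_mapsTo {c ρ lo hi : ℝ} (hc0 : 0 ≤ c) (hρ : 0 ≤ ρ) (hρlo : ρ ≤ lo)
    (hlo : 6400 ≤ tiltArg c ρ lo) (hhi : tiltArg c ρ hi ≤ 17956) :
    Set.MapsTo (fun t => Real.sqrt (tiltArg c ρ t)) (Set.Icc lo hi) (Set.Icc 80 134) := by
  intro t ht
  have h1 : 6400 ≤ tiltArg c ρ t := le_trans hlo (tiltArg_mono_d hc0 hρ hρlo ht.1)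
  have h2 : tiltArg c ρ t ≤ 17956 := le_trans (tiltArg_mono_d hc0 hρ (le_trans hρlo ht.1) ht.2) hhi
  constructor
  · rw [show (80 : ℝ) = Real.sqrt (80 ^ 2) by rw [Real.sqrt_sq (by norm_num)]]
    exact Real.sqrt_le_sqrt (by linarith)
  · rw [show (134 : ℝ) = Real.sqrt (134 ^ 2) by rw [Real.sqrt_sq (by norm_num)]]
    exact Real.sqrt_le_sqrt (by linarith)

/-- ★★★ **THE TILT WEIGHTS ARE CONVEX IN THE DEPTH VARIABLE (PROVED; uses NODE 97's `depthProfile_convexOn`).**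
For `0 ≤ c`, `c² ≤ 2`, `0 ≤ ρ ≤ lo` and `80² ≤ tiltArg c ρ lo`, `tiltArg c ρ hi ≤ 134²`:
`t ↦ depthProfile 160 (√(tiltArg c ρ t))` is convex on `[lo, hi]`. -/
theorem tiltWeight_convexOn {c ρ lo hi : ℝ} (hc0 : 0 ≤ c) (hc : c ^ 2 ≤ 2)
    (hρ : 0 ≤ ρ) (hρlo : ρ ≤ lo) (hlo : 6400 ≤ tiltArg c ρ lo) (hhi : tiltArg c ρ hi ≤ 17956) :
    ConvexOn ℝ (Set.Icc lo hi) (fun t => depthProfile 160 (Real.sqrt (tiltArg c ρ t))) :=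
  convexOn_comp_of_mapsTo depthProfile_convexOn ((depthProfile_monotone (by norm_num : (0:ℝ) < 160)).monotoneOn _)
    ((sqrt_tiltArg_convexOn hc ρ).subset (Set.subset_univ _) (convex_Icc lo hi)) (sqrt_tiltArg_mapsTo hc0 hρ hρlo hlo hhi)

/-! ## §98.4 The «capenv2» tilt rows: exact chord / secant envelopes on a depth cell (fixed `ρ`) -/

/-- ★★★ «capenv2» UPPER tilt row: on a depth cell `[lo, hi]` (fixed `ρ`), each tilt weight lies below its chord. -/
theorem tiltWeight_chord_upper {c ρ lo hi : ℝ} (hc0 : 0 ≤ c) (hc : c ^ 2 ≤ 2)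
    (hρ : 0 ≤ ρ) (hρlo : ρ ≤ lo) (hlo : 6400 ≤ tiltArg c ρ lo) (hhi : tiltArg c ρ hi ≤ 17956) (hlt : lo < hi) :
    ∀ t, lo ≤ t → t ≤ hi →
      depthProfile 160 (Real.sqrt (tiltArg c ρ t)) ≤ depthProfile 160 (Real.sqrt (tiltArg c ρ lo)) +
        (depthProfile 160 (Real.sqrt (tiltArg c ρ hi)) - depthProfile 160 (Real.sqrt (tiltArg c ρ lo))) / (hi - lo) * (t - lo) :=
  fun _ h1 h2 => chord_upper (tiltWeight_convexOn hc0 hc hρ hρlo hlo hhi) ⟨le_rfl, hlt.le⟩ ⟨hlt.le, le_rfl⟩ hlt h1 h2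

/-- ★★★ «capenv2» LOWER tilt row: with an anchor `a < lo` (`ρ ≤ a`, `80² ≤ tiltArg c ρ a`), the secant through `a, lo` extended over `[lo, hi]`
minorises the tilt weight there. -/
theorem tiltWeight_secant_lower {c ρ a lo hi : ℝ} (hc0 : 0 ≤ c) (hc : c ^ 2 ≤ 2)
    (hρ : 0 ≤ ρ) (hρa : ρ ≤ a) (ha : 6400 ≤ tiltArg c ρ a) (hhi : tiltArg c ρ hi ≤ 17956) (halo : a < lo) (hlohi : lo ≤ hi) :
    ∀ t, lo ≤ t → t ≤ hi →
      depthProfile 160 (Real.sqrt (tiltArg c ρ a)) +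
        (depthProfile 160 (Real.sqrt (tiltArg c ρ lo)) - depthProfile 160 (Real.sqrt (tiltArg c ρ a))) / (lo - a) * (t - a) ≤
      depthProfile 160 (Real.sqrt (tiltArg c ρ t)) :=
  fun _ h1 h2 => secant_lower (tiltWeight_convexOn hc0 hc hρ hρa ha hhi) ⟨le_rfl, by linarith⟩ ⟨by linarith, h2⟩ halo h1

end Summit.AtomisticToContinuum.Crystallization.Theorems.ChargedEnergyGapChartDial

end
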